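import Mathlib
import HarnessLib
import Summits.HubbardSuperconductivity.HubbardSuperconductivity.Theorems.WeakCouplingBCSKlCertTPrimePocketRadiusVelocity

/-!
# Route `WeakCouplingBCS` — certificate vocabulary for `WcbcsKohnLuttingerB1g` (stmt-HubbardSuperconductivity-0158):
# the `t′` band radius is SMOOTH (implicit function theorem); `γ' = kltpPolarVelocity` — brick (N1)-3a of «TPRIME-LINDHARD-HS»

Cell `gate-hubbard-kl`, seat margin-1 (g18), zero kit; executed for the p4 lineage's programme «TPRIME-LINDHARD-HS» (pen g27 (R468) «GO (N1)-3»).  The `t′`-twin of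
`Literature/MathematicalPhysics/QuantumLattice/HubbardFermiRadiusSmooth.lean` (`fderiv_rayDispersion_apply`) + `…HubbardFermiRadiusBandSmooth.lean` §1–§2 on the
Γ-centred chart `kltpPolar tp μ` of `…KlCertTPrimePocketRadius.lean` ((N1)-1), with the joint continuity of `…PocketRadiusContinuous.lean` ((N1)-2) as the
local-uniqueness input and the closed forms of `…PocketRadiusVelocity.lean` ((N1)-2b):

* §1 `contDiff_kltpRay_uncurry`, `fderiv_kltpRay_apply` (`DF_{t′}(θ,t)(a,b) = a ∂_θF_{t′} + b ∂_tF_{t′}`);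
* §2 the level function `G_{t′}((μ,θ),t) = F_{t′}(θ,t) − μ`: `contDiff_kltpLevelFun`, `fderiv_kltpLevelFun_apply`, `fderiv_kltpLevelFun_comp_inr_apply`,
  `isInvertible_fderiv_kltpLevelFun_comp_inr` (`∂_tF_{t′} ≠ 0`);
* §3 **`contDiffAt_kltpRadius_uncurry`** (`(μ, θ) ↦ u_{t′,μ}(θ)` is `C^n`, every `n ≤ ω`, on `(−4 − 4t′, 4t′) × ℝ`, `|t′| < 1/2`), `contDiffOn_kltpRadius_uncurry`,
  `contDiff_kltpRadius`, `differentiable_kltpRadius`;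
* §4 **`hasDerivAt_kltpRadius`** (`u' = kltpRadiusDeriv = −∂_θF/∂_tF`), `deriv_kltpRadius`, **`hasDerivAt_kltpPolar`** (`γ' = kltpPolarVelocity`), `continuous_kltpRadiusDeriv`.

No definitions.  Nothing here asserts a record, a margin, `K₃`, `U₀`, the window or superconductivity; a Kohn–Luttinger `O(U²)` channel statement is not ODLRO; nothing
here proves superconductivity in the Hubbard model.
References: G. Benfatto, A. Giuliani, V. Mastropietro, Ann. Henri Poincaré 7 (2006) 809–898, §1 (1.4)–(1.5); S. Raghu, S. A. Kivelson, D. J. Scalapino, Phys. Rev. B 81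
(2010) 224505, §III.
-/

noncomputable section

-- the tree's namespace `Summit.<Summit>.<Problem>.Theorems` repeats the summit name by design (D-0017)
set_option linter.dupNamespace false

namespace Summit.HubbardSuperconductivity.HubbardSuperconductivity.Theorems

open Real Set Filter Literature.MathematicalPhysics.QuantumLattice
open scoped Topology ContDiff

/-! ### §1 The uncurried ray function `F_{t′} : ℝ × ℝ → ℝ` and its Fréchet derivative -/

/-- The uncurried `t′` ray function `(θ, t) ↦ F_{t′}(θ, t)` is real-analytic (hence `C^n` for every `n`). [folklore] -/
theorem contDiff_kltpRay_uncurry (tp : ℝ) {n : WithTop ℕ∞} : ContDiff ℝ n fun p : ℝ × ℝ => kltpRay tp p.1 p.2 := by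
  unfold kltpRay; fun_prop

/-- The Fréchet derivative of `F_{t′}` in terms of the two partials: `DF_{t′}(θ, t)(a, b) = a ∂_θF_{t′} + b ∂_tF_{t′}`. [folklore] -/
theorem fderiv_kltpRay_apply (tp θ t a b : ℝ) :
    fderiv ℝ (fun p : ℝ × ℝ => kltpRay tp p.1 p.2) (θ, t) (a, b) = a * kltpRayDθ tp θ t + b * kltpRayDt tp θ t := by
  set F : ℝ × ℝ → ℝ := fun p => kltpRay tp p.1 p.2 with hFdef
  have hF : HasFDerivAt F (fderiv ℝ F (θ, t)) (θ, t) :=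
    (((contDiff_kltpRay_uncurry tp (n := 1)).differentiable one_ne_zero) (θ, t)).hasFDerivAt
  have h1 : fderiv ℝ F (θ, t) (1, 0) = kltpRayDθ tp θ t := by
    have hg : HasDerivAt (fun ϑ : ℝ => ((ϑ, t) : ℝ × ℝ)) ((1 : ℝ), (0 : ℝ)) θ :=
      (hasDerivAt_id θ).prodMk (hasDerivAt_const θ t)
    have hc : HasDerivAt (F ∘ fun ϑ : ℝ => ((ϑ, t) : ℝ × ℝ)) (fderiv ℝ F (θ, t) (1, 0)) θ :=
      HasFDerivAt.comp_hasDerivAt (l := F) (f := fun ϑ : ℝ => ((ϑ, t) : ℝ × ℝ)) θ hF hg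
    exact hc.unique (hasDerivAt_kltpRay_angle tp θ t)
  have h2 : fderiv ℝ F (θ, t) (0, 1) = kltpRayDt tp θ t := by
    have hg : HasDerivAt (fun s : ℝ => ((θ, s) : ℝ × ℝ)) ((0 : ℝ), (1 : ℝ)) t :=
      (hasDerivAt_const t θ).prodMk (hasDerivAt_id t)
    have hc : HasDerivAt (F ∘ fun s : ℝ => ((θ, s) : ℝ × ℝ)) (fderiv ℝ F (θ, t) (0, 1)) t :=
      HasFDerivAt.comp_hasDerivAt (l := F) (f := fun s : ℝ => ((θ, s) : ℝ × ℝ)) t hF hg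
    exact hc.unique (hasDerivAt_kltpRay tp θ t)
  have hab : ((a, b) : ℝ × ℝ) = a • ((1 : ℝ), (0 : ℝ)) + b • ((0 : ℝ), (1 : ℝ)) := by
    ext <;> simp
  rw [hab, map_add, map_smul, map_smul, h1, h2, smul_eq_mul, smul_eq_mul]

/-! ### §2 The level function with the level as a variable: `G_{t′}((μ, θ), t) = F_{t′}(θ, t) − μ` -/

/-- `G_{t′}` is real-analytic. [folklore] -/
theorem contDiff_kltpLevelFun (tp : ℝ) {n : WithTop ℕ∞} :
    ContDiff ℝ n (fun x : (ℝ × ℝ) × ℝ => kltpRay tp x.1.2 x.2 - x.1.1) := by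
  unfold kltpRay; fun_prop

/-- The Fréchet derivative of `G_{t′}`: `DG((μ,θ),t)((a,b),c) = b ∂_θF + c ∂_tF − a`. [folklore] -/
theorem fderiv_kltpLevelFun_apply (tp μ θ t a b c : ℝ) :
    fderiv ℝ (fun x : (ℝ × ℝ) × ℝ => kltpRay tp x.1.2 x.2 - x.1.1) ((μ, θ), t) ((a, b), c) =
      b * kltpRayDθ tp θ t + c * kltpRayDt tp θ t - a := by
  set F : ℝ × ℝ → ℝ := fun p => kltpRay tp p.1 p.2 with hFdef
  set L : (ℝ × ℝ) × ℝ →L[ℝ] ℝ × ℝ :=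
    ((ContinuousLinearMap.snd ℝ ℝ ℝ).comp (ContinuousLinearMap.fst ℝ (ℝ × ℝ) ℝ)).prod
      (ContinuousLinearMap.snd ℝ (ℝ × ℝ) ℝ) with hL
  set P : (ℝ × ℝ) × ℝ →L[ℝ] ℝ :=
    (ContinuousLinearMap.fst ℝ ℝ ℝ).comp (ContinuousLinearMap.fst ℝ (ℝ × ℝ) ℝ) with hP
  have hLf : HasFDerivAt (fun x : (ℝ × ℝ) × ℝ => ((x.1.2, x.2) : ℝ × ℝ)) L ((μ, θ), t) := L.hasFDerivAt
  have hPf : HasFDerivAt (fun x : (ℝ × ℝ) × ℝ => x.1.1) P ((μ, θ), t) := P.hasFDerivAt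
  have hF : HasFDerivAt F (fderiv ℝ F (θ, t)) (θ, t) :=
    (((contDiff_kltpRay_uncurry tp (n := 1)).differentiable one_ne_zero) (θ, t)).hasFDerivAt
  have hcomp : HasFDerivAt (fun x : (ℝ × ℝ) × ℝ => F (x.1.2, x.2)) ((fderiv ℝ F (θ, t)).comp L) ((μ, θ), t) :=
    HasFDerivAt.comp (((μ, θ), t) : (ℝ × ℝ) × ℝ) (g := F) (f := fun x : (ℝ × ℝ) × ℝ => ((x.1.2, x.2) : ℝ × ℝ)) hF hLf
  have hG : HasFDerivAt (fun x : (ℝ × ℝ) × ℝ => F (x.1.2, x.2) - x.1.1) ((fderiv ℝ F (θ, t)).comp L - P) ((μ, θ), t) :=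
    hcomp.sub hPf
  have hfun : (fun x : (ℝ × ℝ) × ℝ => kltpRay tp x.1.2 x.2 - x.1.1) = fun x : (ℝ × ℝ) × ℝ => F (x.1.2, x.2) - x.1.1 := by
    funext x; simp [hFdef]
  rw [hfun, hG.fderiv]
  simp [hL, hP, hFdef, fderiv_kltpRay_apply]

/-- The `t`-partial of `G_{t′}` is multiplication by `∂_tF_{t′}`. [folklore] -/
theorem fderiv_kltpLevelFun_comp_inr_apply (tp μ θ t c : ℝ) :
    (fderiv ℝ (fun x : (ℝ × ℝ) × ℝ => kltpRay tp x.1.2 x.2 - x.1.1) ((μ, θ), t) ∘L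
      ContinuousLinearMap.inr ℝ (ℝ × ℝ) ℝ) c = c * kltpRayDt tp θ t := by
  rw [ContinuousLinearMap.comp_apply, ContinuousLinearMap.inr_apply]
  have h := fderiv_kltpLevelFun_apply tp μ θ t 0 0 c
  simp only [Prod.mk_zero_zero] at h ⊢
  rw [h]; ring

/-- Where `∂_tF_{t′} ≠ 0` the `t`-partial of `G_{t′}` is invertible. [folklore] -/
theorem isInvertible_fderiv_kltpLevelFun_comp_inr {tp μ θ t : ℝ} (h : kltpRayDt tp θ t ≠ 0) :
    (fderiv ℝ (fun x : (ℝ × ℝ) × ℝ => kltpRay tp x.1.2 x.2 - x.1.1) ((μ, θ), t) ∘L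
      ContinuousLinearMap.inr ℝ (ℝ × ℝ) ℝ).IsInvertible := by
  refine ⟨ContinuousLinearEquiv.unitsEquivAut ℝ (Units.mk0 _ h), ContinuousLinearMap.ext_ring ?_⟩
  rw [ContinuousLinearEquiv.coe_coe, ContinuousLinearEquiv.unitsEquivAut_apply, Units.val_mk0,
    fderiv_kltpLevelFun_comp_inr_apply]

/-! ### §3 Smoothness of the `t′` band radius, jointly in the level and the angle -/

/-- **`(μ, θ) ↦ u_{t′,μ}(θ)` is `C^n` at every point of the Γ-pocket window `(−4 − 4t′, 4t′) × ℝ`** (every `n ≤ ω`; `|t′| < 1/2`): the implicit function theorem for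
`G_{t′}` at the polar point (`∂_tF_{t′} > 0`, `kltpRayDt_kltpRadius_pos`), plus local uniqueness against the jointly continuous solution `u` (`continuousOn_kltpRadius`).
[folklore] -/
theorem contDiffAt_kltpRadius_uncurry {tp μ θ : ℝ} (htp : |tp| < 1 / 2) (hμ₁ : -4 - 4 * tp < μ) (hμ₂ : μ < 4 * tp)
    {n : WithTop ℕ∞} : ContDiffAt ℝ n (fun p : ℝ × ℝ => kltpRadius tp p.1 p.2) (μ, θ) := by
  suffices h : ContDiffAt ℝ ω (fun p : ℝ × ℝ => kltpRadius tp p.1 p.2) (μ, θ) from h.of_le le_top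
  set G : (ℝ × ℝ) × ℝ → ℝ := fun x => kltpRay tp x.1.2 x.2 - x.1.1 with hG
  have cdf : ContDiffAt ℝ ω G ((μ, θ), kltpRadius tp μ θ) := (contDiff_kltpLevelFun tp).contDiffAt
  have pn : (ω : WithTop ℕ∞) ≠ 0 := by simp
  have if₂ := isInvertible_fderiv_kltpLevelFun_comp_inr (tp := tp) (μ := μ)
    (kltpRayDt_kltpRadius_pos htp hμ₁ hμ₂ θ).ne'
  have hψ : ContDiffAt ℝ ω (cdf.implicitFunction pn if₂) (μ, θ) := cdf.contDiffAt_implicitFunction pn if₂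
  have hev := cdf.eventually_apply_eq_iff_implicitFunction pn if₂
  have hUopen : IsOpen (Ioo (-4 - 4 * tp) (4 * tp) ×ˢ (univ : Set ℝ)) := isOpen_Ioo.prod isOpen_univ
  have hmem : ((μ, θ) : ℝ × ℝ) ∈ Ioo (-4 - 4 * tp) (4 * tp) ×ˢ (univ : Set ℝ) := ⟨⟨hμ₁, hμ₂⟩, mem_univ _⟩
  have hcontAt : ContinuousAt (fun p : ℝ × ℝ => kltpRadius tp p.1 p.2) (μ, θ) :=
    (continuousOn_kltpRadius htp).continuousAt (hUopen.mem_nhds hmem)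
  have hcont : Tendsto (fun p : ℝ × ℝ => ((p, kltpRadius tp p.1 p.2) : (ℝ × ℝ) × ℝ)) (𝓝 (μ, θ))
      (𝓝 ((μ, θ), kltpRadius tp μ θ)) :=
    continuousAt_id.prodMk hcontAt
  have hU : ∀ᶠ p : ℝ × ℝ in 𝓝 (μ, θ), p.1 ∈ Ioo (-4 - 4 * tp) (4 * tp) :=
    continuous_fst.continuousAt.eventually (isOpen_Ioo.mem_nhds ⟨hμ₁, hμ₂⟩)
  have heq : (fun p : ℝ × ℝ => kltpRadius tp p.1 p.2) =ᶠ[𝓝 (μ, θ)] cdf.implicitFunction pn if₂ := by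
    filter_upwards [hcont.eventually hev, hU] with p hp hpU
    have hGp : G (p, kltpRadius tp p.1 p.2) = G ((μ, θ), kltpRadius tp μ θ) := by
      simp only [hG]
      rw [kltpRay_kltpRadius htp hpU.1 hpU.2, kltpRay_kltpRadius htp hμ₁ hμ₂, sub_self, sub_self]
    exact (hp.1 hGp).symm
  exact hψ.congr_of_eventuallyEq heq

/-- **`(μ, θ) ↦ u_{t′,μ}(θ)` is `C^n` on the window.** [folklore] -/
theorem contDiffOn_kltpRadius_uncurry {tp : ℝ} (htp : |tp| < 1 / 2) {n : WithTop ℕ∞} :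
    ContDiffOn ℝ n (fun p : ℝ × ℝ => kltpRadius tp p.1 p.2) (Ioo (-4 - 4 * tp) (4 * tp) ×ˢ univ) :=
  fun _ hp => (contDiffAt_kltpRadius_uncurry htp hp.1.1 hp.1.2).contDiffWithinAt

/-- **`θ ↦ u_{t′,μ}(θ)` is `C^n`** on the window. [folklore] -/
theorem contDiff_kltpRadius {tp μ : ℝ} (htp : |tp| < 1 / 2) (hμ₁ : -4 - 4 * tp < μ) (hμ₂ : μ < 4 * tp) {n : WithTop ℕ∞} :
    ContDiff ℝ n (kltpRadius tp μ) := by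
  have h : ContDiff ℝ n ((fun p : ℝ × ℝ => kltpRadius tp p.1 p.2) ∘ fun θ : ℝ => ((μ, θ) : ℝ × ℝ)) :=
    contDiff_iff_contDiffAt.2 fun θ =>
      (contDiffAt_kltpRadius_uncurry htp hμ₁ hμ₂).comp θ (contDiff_prodMk_right μ).contDiffAt
  exact h

/-- `u_{t′,μ}` is differentiable in the angle. [folklore] -/
theorem differentiable_kltpRadius {tp μ : ℝ} (htp : |tp| < 1 / 2) (hμ₁ : -4 - 4 * tp < μ) (hμ₂ : μ < 4 * tp) :
    Differentiable ℝ (kltpRadius tp μ) :=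
  (contDiff_kltpRadius htp hμ₁ hμ₂ (n := 1)).differentiable one_ne_zero

/-! ### §4 The first derivatives in closed form -/

section Deriv

variable {tp μ : ℝ} (htp : |tp| < 1 / 2) (hμ₁ : -4 - 4 * tp < μ) (hμ₂ : μ < 4 * tp)
include htp hμ₁ hμ₂

/-- **The angular derivative of the `t′` band radius IS `kltpRadiusDeriv`**: `∂_θ u = −∂_θF_{t′}(θ,u)/∂_tF_{t′}(θ,u)` (differentiate `F_{t′}(θ, u(θ)) = μ`).
[folklore] -/
theorem hasDerivAt_kltpRadius (θ : ℝ) : HasDerivAt (kltpRadius tp μ) (kltpRadiusDeriv tp μ θ) θ := by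
  set F : ℝ × ℝ → ℝ := fun p => kltpRay tp p.1 p.2 with hFdef
  have hu : HasDerivAt (kltpRadius tp μ) (deriv (kltpRadius tp μ) θ) θ :=
    (differentiable_kltpRadius htp hμ₁ hμ₂ θ).hasDerivAt
  have hF : HasFDerivAt F (fderiv ℝ F (θ, kltpRadius tp μ θ)) (θ, kltpRadius tp μ θ) :=
    (((contDiff_kltpRay_uncurry tp (n := 1)).differentiable one_ne_zero) _).hasFDerivAt
  have hg : HasDerivAt (fun ϑ : ℝ => ((ϑ, kltpRadius tp μ ϑ) : ℝ × ℝ)) ((1 : ℝ), deriv (kltpRadius tp μ) θ) θ :=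
    (hasDerivAt_id θ).prodMk hu
  have hG : HasDerivAt (F ∘ fun ϑ : ℝ => ((ϑ, kltpRadius tp μ ϑ) : ℝ × ℝ))
      (fderiv ℝ F (θ, kltpRadius tp μ θ) (1, deriv (kltpRadius tp μ) θ)) θ :=
    HasFDerivAt.comp_hasDerivAt (l := F) (f := fun ϑ : ℝ => ((ϑ, kltpRadius tp μ ϑ) : ℝ × ℝ)) θ hF hg
  have hG0 : HasDerivAt (F ∘ fun ϑ : ℝ => ((ϑ, kltpRadius tp μ ϑ) : ℝ × ℝ)) 0 θ := by
    have : (F ∘ fun ϑ : ℝ => ((ϑ, kltpRadius tp μ ϑ) : ℝ × ℝ)) = fun _ => μ :=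
      funext fun ϑ => kltpRay_kltpRadius htp hμ₁ hμ₂ ϑ
    rw [this]
    exact hasDerivAt_const θ μ
  have hrel := hG.unique hG0
  rw [hFdef, fderiv_kltpRay_apply, one_mul] at hrel
  have hDt : kltpRayDt tp θ (kltpRadius tp μ θ) ≠ 0 := (kltpRayDt_kltpRadius_pos htp hμ₁ hμ₂ θ).ne'
  have hval : deriv (kltpRadius tp μ) θ = kltpRadiusDeriv tp μ θ := by
    rw [kltpRadiusDeriv, eq_div_iff hDt]
    linarith
  rwa [hval] at hu

/-- `deriv u_{t′,μ} = kltpRadiusDeriv tp μ`. [folklore] -/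
theorem deriv_kltpRadius (θ : ℝ) : deriv (kltpRadius tp μ) θ = kltpRadiusDeriv tp μ θ :=
  (hasDerivAt_kltpRadius htp hμ₁ hμ₂ θ).deriv

/-- **The velocity IS the derivative of the polar point**: `HasDerivAt (kltpPolar tp μ) (kltpPolarVelocity tp μ θ) θ`. [folklore] -/
theorem hasDerivAt_kltpPolar (θ : ℝ) : HasDerivAt (kltpPolar tp μ) (kltpPolarVelocity tp μ θ) θ := by
  have hu := hasDerivAt_kltpRadius htp hμ₁ hμ₂ θ
  have hc : HasDerivAt (fun ϑ => kltpRadius tp μ ϑ * Real.cos ϑ)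
      (kltpRadiusDeriv tp μ θ * Real.cos θ + kltpRadius tp μ θ * -Real.sin θ) θ := hu.mul (Real.hasDerivAt_cos θ)
  have hs : HasDerivAt (fun ϑ => kltpRadius tp μ ϑ * Real.sin ϑ)
      (kltpRadiusDeriv tp μ θ * Real.sin θ + kltpRadius tp μ θ * Real.cos θ) θ := hu.mul (Real.hasDerivAt_sin θ)
  have hpi : HasDerivAt (fun ϑ => (kltpRadius tp μ ϑ • dir ϑ : Fin 2 → ℝ))
      (kltpRadiusDeriv tp μ θ • dir θ + kltpRadius tp μ θ • ![-Real.sin θ, Real.cos θ]) θ := by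
    rw [hasDerivAt_pi]
    intro i
    fin_cases i
    · simpa [dir, smul_eq_mul] using hc
    · simpa [dir, smul_eq_mul] using hs
  have hL := (PiLp.continuousLinearEquiv 2 ℝ (fun _ : Fin 2 => ℝ)).symm.toContinuousLinearMap.hasFDerivAt.comp_hasDerivAt θ hpi
  exact hL

end Deriv

/-- **The `t′` velocity and density of states are continuous in the angle.** [folklore] -/
theorem continuous_kltpRadiusDeriv {tp μ : ℝ} (htp : |tp| < 1 / 2) (hμ₁ : -4 - 4 * tp < μ) (hμ₂ : μ < 4 * tp) :
    Continuous (kltpRadiusDeriv tp μ) := by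
  have h := (contDiff_kltpRadius htp hμ₁ hμ₂ (n := 1)).continuous_deriv le_rfl
  exact h.congr fun θ => deriv_kltpRadius htp hμ₁ hμ₂ θ

end Summit.HubbardSuperconductivity.HubbardSuperconductivity.Theorems

end
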